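import Mathlib
import Summits.KontsevichZagierPeriods.Zeta5Search.RecordRayDominanceTop
import Summits.KontsevichZagierPeriods.Zeta5Search.RecordRayDominanceMid
import Summits.KontsevichZagierPeriods.Zeta5Search.RecordCellAClassDataProof
import HarnessLib

/-!
# ζ(5) search — `RecordRayDominance` and `RecordRayCV` are THEOREMS: (CV) on Brown–Zudilin's record ray for ALL `n` and ALL window primes

Cell `pub-zeta5` (HONEST FRAMING: systematic search; no irrationality claim unless certified), TRACK «DENOM-LAW» D1 prover seat
(denom-prover-d1 g11, `HOME/denom-law/prover-d1/ATTEMPT-11.md` §4).  Discharges BY NAME gen-2 g8's `@[conjecture]` nodes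
`ClusterValuation.RecordRayDominance` (`refund − N_p ≤ casLB(b(n),p)` for all `n ≥ 1` and primes `5 ≤ p ≤ 41n` on the record ray
`b(n) = n·(41;17,16,15,14,13,12,11)`) and — through the landed `recordRayCV_of_dominance` (THEOREM LB) — `ClusterValuation.RecordRayCV`:
**(CV) `v_p(Cas_j(b(n))) ≥ min(1,⌊25n/p⌋) − N_p` at EVERY window prime `5 ≤ p ≤ 41n`, `p² > 41n + 2`, for ALL `n ≥ 1` and all `1 ≤ j ≤ 7`.**

ASSEMBLY by `θ = p/n`:
* `p ≤ 12n` — counting (`recordRayDominance_le_twelve`, tree: `SmallPrimeDominance` + `RecordRayDominanceMid`);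
* `12n < p < 14n` — THIS FILE, §1: every class has `E_x ≥ −5` (points `x`, `x+p`, `x+2p`, `x+3p` read on P1 g5's depth table `CellA.dep7`:
  below `11n` a zero, a pole of depth `d₁`, a point of depth `d₂` with `d₁ + d₂ ≤ 8`; on `[11n,13n)` a point of depth `≤ 2`, a pole of depth
  `≤ 7 / ≤ 6`, a zero above `35n`; on `[13n,p)` depths `≤ 3` and `≤ 4`), hence `casLB ≥ −5 − 2 = −7 ≥ 1 − N_p` (`N_p ∈ {12, 9}`);
* `14n < p < 15n` — the tree's cell A (`CellA.casLB_bRecA`: `casLB = −5`; `N_p = 6`);  `15n < p < 16n` — `Cell1516.casLB_ge16` (`≥ −3`; `N_p = 4`);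
* `16n < p ≤ 41n` — `RecordRayTop.casLB_ge17 / 18 / 25 / 41` (`≥ −1, 0, 1, 0`) against `N_p ∈ {2, 1, 0, 0}`, `refund ∈ {1, 1, 1, 0}`;
* `p ∈ {14n, 15n, 16n}` is not prime.
Integer bookkeeping on the cell's own class data; nothing about irrationality.
-/

open Finset

namespace Summit.KontsevichZagierPeriods.Zeta5Search.RecordRayMid14

open Summit.KontsevichZagierPeriods.Zeta5Search.ClusterValuation
open Summit.KontsevichZagierPeriods.Zeta5Search.CasoratianValuation (InPolytope pairFloors refund shift casoratian)
open Summit.KontsevichZagierPeriods.Zeta5Search.CellA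
open Summit.KontsevichZagierPeriods.Zeta5Search.RecordRayTop (self_mem_class add_mem_class)

/-! ### §1 `12n < p < 14n`: every class has `E_x ≥ −5` -/

/-- Lower blocks: `q < (11+k)n` has depth `≤ k`. -/
theorem dep7_le_low {n q k : ℕ} (hk : k ≤ 7) (h : q < (11 + k) * n) : dep7 n q ≤ k := by
  interval_cases k <;> unfold dep7 <;> split_ifs <;> omega

/-- Upper blocks: `(30−k)n < q` has depth `≤ k`. -/
theorem dep7_le_high {n q k : ℕ} (hk : k ≤ 7) (h : (30 - k) * n < q) : dep7 n q ≤ k := by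
  interval_cases k <;> unfold dep7 <;> split_ifs <;> omega

/-- `netExp ≥ 1 − depth` (the centre only adds). -/
theorem netExp_ge (n q : ℕ) : 1 - (dep7 n q : ℤ) ≤ netExp (bRec n) q := by
  rw [netExp_bRec]; split_ifs <;> omega

section Cells

variable {n p x : ℕ} (hp12 : 12 * n < p) (hp14 : p < 14 * n) (hx : x < p)

include hp12 hx in
/-- The class of `x`: its points among `x + kp`, `k ≤ 3` (the last three only when `≤ 41n`). -/
theorem mem_class_cases4 {s : ℕ} (hs : s ∈ classSet (bRec n) p x) :
    s = x ∨ (s = x + p ∧ x + p ≤ 41 * n) ∨ (s = x + 2 * p ∧ x + 2 * p ≤ 41 * n) ∨ (s = x + 3 * p ∧ x + 3 * p ≤ 41 * n) := by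
  rw [mem_classSet_iff, bRec_zero_toNat] at hs
  obtain ⟨hs41, k, hk⟩ := hs
  have hk0 : 0 ≤ k := by
    by_contra hneg
    push Not at hneg
    have : (p : ℤ) * k ≤ (p : ℤ) * (-1) := mul_le_mul_of_nonneg_left (by omega) (by omega)
    omega
  have hk4 : k < 4 := by
    by_contra hge
    push Not at hge
    have : (p : ℤ) * 4 ≤ (p : ℤ) * k := mul_le_mul_of_nonneg_left hge (by omega)
    omega
  interval_cases k
  · left; omega
  · right; left; constructor <;> omega
  · right; right; left; constructor <;> omega
  · right; right; right; constructor <;> omega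

/-- `x + 2p ∈ class` when `≤ 41n` (`x` and `x + p`: `RecordRayTop.self_mem_class` / `add_mem_class`). -/
theorem mem2 (h : x + 2 * p ≤ 41 * n) : x + 2 * p ∈ classSet (bRec n) p x := by
  rw [mem_classSet_iff, bRec_zero_toNat]; exact ⟨h, 2, by push_cast; ring⟩

/-- `E_x` is at least the exponent sum over a sub-family `S` of the class whose complement in the class carries no pole. -/
theorem classExp_ge_sub (S : Finset ℕ) (hS : S ⊆ classSet (bRec n) p x)
    (hrest : ∀ s ∈ classSet (bRec n) p x, s ∉ S → 0 ≤ netExp (bRec n) s) :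
    ∑ s ∈ S, netExp (bRec n) s ≤ classExp (bRec n) p x := by
  refine le_trans ?_ (classExp_ge_sum _ _ _)
  rw [← sum_sdiff hS]
  have : 0 ≤ ∑ s ∈ classSet (bRec n) p x \ S, netExp (bRec n) s :=
    sum_nonneg fun s hs => hrest s (mem_sdiff.1 hs).1 (mem_sdiff.1 hs).2
  linarith

include hp12 hp14 hx in
/-- **Every class has `E_x ≥ −5`** for `12n < p < 14n`. -/
theorem classExp_ge_neg5 : (-5 : ℤ) ≤ classExp (bRec n) p x := by
  have hv41 : x + p ≤ 41 * n := by omega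
  have gx := netExp_ge n x
  have gv := netExp_ge n (x + p)
  have gw := netExp_ge n (x + 2 * p)
  have d1le := dep7_le n (x + p)
  -- the fourth point, if present, is a zero
  have hu : x + 3 * p ≤ 41 * n → 0 ≤ netExp (bRec n) (x + 3 * p) := fun h => by
    have := netExp_ge n (x + 3 * p); have := dep7_high (n := n) (q := x + 3 * p) (by omega); omega
  by_cases hx13 : x < 13 * n
  · -- three points `x, x+p, x+2p` (and possibly a zero `x+3p`)
    have hw41 : x + 2 * p ≤ 41 * n := by omega
    have hsub : ({x, x + p, x + 2 * p} : Finset ℕ) ⊆ classSet (bRec n) p x := by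
      intro s hs
      simp only [mem_insert, mem_singleton] at hs
      rcases hs with rfl | rfl | rfl
      · exact self_mem_class (by omega) hx
      · exact add_mem_class hv41
      · exact mem2 hw41
    have hrest : ∀ s ∈ classSet (bRec n) p x, s ∉ ({x, x + p, x + 2 * p} : Finset ℕ) → 0 ≤ netExp (bRec n) s := by
      intro s hs hns
      rcases mem_class_cases4 hp12 hx hs with rfl | ⟨rfl, -⟩ | ⟨rfl, -⟩ | ⟨rfl, h3⟩
      · simp at hns
      · simp at hns
      · simp at hns
      · exact hu h3
    have hE := classExp_ge_sub ({x, x + p, x + 2 * p} : Finset ℕ) hsub hrest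
    rw [sum_insert (by simp; omega), sum_pair (by omega)] at hE
    -- depth bookkeeping
    by_cases hx11 : x < 11 * n
    · have e0 : dep7 n x = 0 := dep7_low hx11
      -- `d₁ + d₂ ≤ 8`
      have h8 : dep7 n (x + p) + dep7 n (x + 2 * p) ≤ 8 := by
        by_cases h1 : x + p < 13 * n
        · have := dep7_le_low (n := n) (q := x + p) (k := 2) (by norm_num) (by omega)
          have := dep7_le_high (n := n) (q := x + 2 * p) (k := 6) (by norm_num) (by omega)
          omega
        by_cases h2 : x + p < 14 * n
        · have := dep7_le_low (n := n) (q := x + p) (k := 3) (by norm_num) (by omega)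
          have := dep7_le_high (n := n) (q := x + 2 * p) (k := 5) (by norm_num) (by omega)
          omega
        by_cases h3 : x + p < 15 * n
        · have := dep7_le_low (n := n) (q := x + p) (k := 4) (by norm_num) (by omega)
          have := dep7_le_high (n := n) (q := x + 2 * p) (k := 4) (by norm_num) (by omega)
          omega
        by_cases h4 : x + p < 16 * n
        · have := dep7_le_low (n := n) (q := x + p) (k := 5) (by norm_num) (by omega)
          have := dep7_le_high (n := n) (q := x + 2 * p) (k := 3) (by norm_num) (by omega)
          omega
        by_cases h5 : x + p < 17 * n
        · have := dep7_le_low (n := n) (q := x + p) (k := 6) (by norm_num) (by omega)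
          have := dep7_le_high (n := n) (q := x + 2 * p) (k := 2) (by norm_num) (by omega)
          omega
        · have := dep7_le_high (n := n) (q := x + 2 * p) (k := 1) (by norm_num) (by omega)
          omega
      rw [e0] at gx
      push_cast at gx h8 ⊢
      have : ((dep7 n (x + p) : ℕ) : ℤ) + ((dep7 n (x + 2 * p) : ℕ) : ℤ) ≤ 8 := by exact_mod_cast h8
      linarith
    by_cases hx12 : x < 12 * n
    · -- neutral, pole of depth ≤ 7, zero above `35n`
      have e0 := dep7_le_low (n := n) (q := x) (k := 1) (by norm_num) (by omega)
      have e2 : dep7 n (x + 2 * p) = 0 := dep7_high (by omega)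
      have : ((dep7 n x : ℕ) : ℤ) ≤ 1 := by exact_mod_cast e0
      have : ((dep7 n (x + p) : ℕ) : ℤ) ≤ 7 := by exact_mod_cast d1le
      rw [e2] at gw
      push_cast at gw
      linarith
    · -- simple pole, pole of depth ≤ 6, zero above `36n`
      have e0 := dep7_le_low (n := n) (q := x) (k := 2) (by norm_num) (by omega)
      have e1 := dep7_le_high (n := n) (q := x + p) (k := 6) (by norm_num) (by omega)
      have e2 : dep7 n (x + 2 * p) = 0 := dep7_high (by omega)
      have : ((dep7 n x : ℕ) : ℤ) ≤ 2 := by exact_mod_cast e0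
      have : ((dep7 n (x + p) : ℕ) : ℤ) ≤ 6 := by exact_mod_cast e1
      rw [e2] at gw
      push_cast at gw
      linarith
  · -- `13n ≤ x < p < 14n`: two points of depth `≤ 3` and `≤ 4` (a possible third point is a zero)
    have hsub : ({x, x + p} : Finset ℕ) ⊆ classSet (bRec n) p x := by
      intro s hs
      simp only [mem_insert, mem_singleton] at hs
      rcases hs with rfl | rfl
      · exact self_mem_class (by omega) hx
      · exact add_mem_class hv41
    have hrest : ∀ s ∈ classSet (bRec n) p x, s ∉ ({x, x + p} : Finset ℕ) → 0 ≤ netExp (bRec n) s := by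
      intro s hs hns
      rcases mem_class_cases4 hp12 hx hs with rfl | ⟨rfl, -⟩ | ⟨rfl, h2⟩ | ⟨rfl, h3⟩
      · simp at hns
      · simp at hns
      · have := dep7_high (n := n) (q := x + 2 * p) (by omega); omega
      · exact hu h3
    have hE := classExp_ge_sub ({x, x + p} : Finset ℕ) hsub hrest
    rw [sum_pair (by omega)] at hE
    have e0 := dep7_le_low (n := n) (q := x) (k := 3) (by norm_num) (by omega)
    have e1 := dep7_le_high (n := n) (q := x + p) (k := 4) (by norm_num) (by omega)
    have : ((dep7 n x : ℕ) : ℤ) ≤ 3 := by exact_mod_cast e0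
    have : ((dep7 n (x + p) : ℕ) : ℤ) ≤ 4 := by exact_mod_cast e1
    linarith

end Cells

/-- **`casLB(b(n),p) ≥ −7`** for `12n < p < 14n` (`VB ≥ −5`, rows `≥ −2`). -/
theorem casLB_ge14 {n p : ℕ} (hp12 : 12 * n < p) (hp14 : p < 14 * n) : -7 ≤ casLB (bRec n) p := by
  rcases casLB_ge_or_noPole (bRec n) p (-5) (-2)
      (fun x hx _ => (classExp_ge_neg5 hp12 hp14 hx).trans (classExp_le_classNu _ _ _)) (by norm_num)
      (fun x hx _ => by linarith [classExp_ge_neg5 hp12 hp14 hx]) (fun _ => by norm_num) with ⟨h0, -⟩ | h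
  · rw [h0]; norm_num
  · linarith

/-! ### §2 `refund` and `N_p` for `p > 12n` -/

/-- `refund(b(n),p) = 1` for `0 < p ≤ 25n`. -/
theorem refund_bRec_eq_one {n p : ℕ} (hp0 : 0 < p) (hp : p ≤ 25 * n) : refund (bRec n) p = 1 := by
  unfold refund
  rw [dOf_bRec]
  apply min_eq_left
  have hpZ : (0 : ℤ) < p := by exact_mod_cast hp0
  rw [Int.le_ediv_iff_mul_le hpZ]; omega

/-- `refund(b(n),p) = 0` for `p > 25n`. -/
theorem refund_bRec_eq_zero {n p : ℕ} (hp : 25 * n < p) : refund (bRec n) p = 0 := by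
  unfold refund
  rw [dOf_bRec, Int.ediv_eq_zero_of_lt (by positivity) (by omega)]
  norm_num

/-- `N_p(b(n)) = 3[p ≤ 13n] + 3[p ≤ 14n] + 2[p ≤ 15n] + 2[p ≤ 16n] + [p ≤ 17n] + [p ≤ 18n]` for `p > 12n`
(pair blocks `13n` ×3, `14n` ×3, `15n` ×2, `16n` ×2, `17n`, `18n`; each at most once since `18n < 2p`). -/
theorem pairFloors_bRec_mid {n p : ℕ} (hp : 12 * n < p) :
    pairFloors (bRec n) p = 3 * (if p ≤ 13 * n then 1 else 0) + 3 * (if p ≤ 14 * n then 1 else 0) +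
      2 * (if p ≤ 15 * n then 1 else 0) + 2 * (if p ≤ 16 * n then 1 else 0) +
      (if p ≤ 17 * n then 1 else 0) + (if p ≤ 18 * n then 1 else 0) := by
  have hp0 : (0 : ℤ) < p := by exact_mod_cast (show 0 < p by omega)
  have hq0 : ∀ (a b : ℤ), 0 ≤ (n : ℤ) * 41 - (n : ℤ) * a - (n : ℤ) * b → (n : ℤ) * 41 - (n : ℤ) * a - (n : ℤ) * b < p →
      ((n : ℤ) * 41 - (n : ℤ) * a - (n : ℤ) * b) / (p : ℤ) = 0 := fun a b h0 h1 => Int.ediv_eq_zero_of_lt h0 h1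
  have hq1 : ∀ (a b : ℤ) (c : ℕ), (41 : ℤ) - a - b = c → c * n < 2 * p →
      ((n : ℤ) * 41 - (n : ℤ) * a - (n : ℤ) * b) / (p : ℤ) = if p ≤ c * n then 1 else 0 := by
    intro a b c h h2
    rw [show (n : ℤ) * 41 - (n : ℤ) * a - (n : ℤ) * b = (c : ℤ) * n by rw [← h]; ring]
    split_ifs with hc
    · rw [Int.ediv_eq_iff_of_pos hp0]; constructor <;> omega
    · exact Int.ediv_eq_zero_of_lt (by positivity) (by omega)
  unfold pairFloors
  simp only [sum_range_succ, sum_range_zero, bRec]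
  norm_num
  rw [hq0 17 16 (by omega) (by omega),
      hq0 17 15 (by omega) (by omega),
      hq0 17 14 (by omega) (by omega),
      hq0 17 13 (by omega) (by omega),
      hq0 17 12 (by omega) (by omega),
      hq0 16 15 (by omega) (by omega),
      hq0 16 14 (by omega) (by omega),
      hq0 16 13 (by omega) (by omega),
      hq0 15 14 (by omega) (by omega),
      hq1 17 11 13 (by norm_num) (by omega),
      hq1 16 12 13 (by norm_num) (by omega),
      hq1 16 11 14 (by norm_num) (by omega),
      hq1 15 13 13 (by norm_num) (by omega),
      hq1 15 12 14 (by norm_num) (by omega),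
      hq1 15 11 15 (by norm_num) (by omega),
      hq1 14 13 14 (by norm_num) (by omega),
      hq1 14 12 15 (by norm_num) (by omega),
      hq1 14 11 16 (by norm_num) (by omega),
      hq1 13 12 16 (by norm_num) (by omega),
      hq1 13 11 17 (by norm_num) (by omega),
      hq1 12 11 18 (by norm_num) (by omega)]
  split_ifs <;> omega

/-- **Dominance for `12n < p < 14n`.** -/
theorem recordRayDominance_mid14 (n p : ℕ) (hp12 : 12 * n < p) (hp14 : p < 14 * n) :
    refund (bRec n) p - pairFloors (bRec n) p ≤ casLB (bRec n) p := by
  rw [refund_bRec_eq_one (by omega) (by omega), pairFloors_bRec_mid hp12]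
  have := casLB_ge14 hp12 hp14
  split_ifs <;> omega

end Summit.KontsevichZagierPeriods.Zeta5Search.RecordRayMid14

/-! ### §3 The nodes by name -/

namespace Summit.KontsevichZagierPeriods.Zeta5Search.ClusterValuation

open Summit.KontsevichZagierPeriods.Zeta5Search.CasoratianValuation (pairFloors refund casoratian)
open Summit.KontsevichZagierPeriods.Zeta5Search.RecordRayMid14

/-- A prime `p ≥ 5` is not `14n`, `15n` or `16n`. -/
theorem prime_ne_mul {p n c : ℕ} (hprime : p.Prime) (hp5 : 5 ≤ p) (hc : c = 14 ∨ c = 15 ∨ c = 16) : p ≠ c * n := by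
  rintro rfl
  rcases hc with rfl | rfl | rfl
  · have := hprime.eq_one_or_self_of_dvd 2 ⟨7 * n, by ring⟩; omega
  · have := hprime.eq_one_or_self_of_dvd 3 ⟨5 * n, by ring⟩; omega
  · have := hprime.eq_one_or_self_of_dvd 2 ⟨8 * n, by ring⟩; omega

/-- **`RecordRayDominance` (gen-2 g8) is a theorem [conjecture node discharged, by name, hypothesis-free]**: on Brown–Zudilin's record ray
the Casoratian class bound dominates the (CV) value, `min(1,⌊25n/p⌋) − N_p ≤ casLB(b(n),p)`, for every `n ≥ 1` and every prime `5 ≤ p ≤ 41n`.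
HONEST FRAMING: integer bookkeeping on the cell's own class data; nothing about irrationality. -/
theorem recordRayDominance_holds : RecordRayDominance := by
  intro n p hn hprime hp5 hp41
  have hp0 : 0 < p := hprime.pos
  by_cases h12 : p ≤ 12 * n
  · exact recordRayDominance_le_twelve n p hp0 h12
  push Not at h12
  by_cases h14 : p < 14 * n
  · exact recordRayDominance_mid14 n p h12 h14
  have h14' : 14 * n < p := lt_of_le_of_ne (by omega) (prime_ne_mul hprime hp5 (Or.inl rfl)).symm
  by_cases h15 : p < 15 * n
  · rw [CellA.casLB_bRecA hn h14' h15 hprime, refund_bRec_eq_one hp0 (by omega), pairFloors_bRec_mid (by omega)]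
    split_ifs <;> omega
  have h15' : 15 * n < p := lt_of_le_of_ne (by omega) (prime_ne_mul hprime hp5 (Or.inr (Or.inl rfl))).symm
  by_cases h16 : p < 16 * n
  · have := Cell1516.casLB_ge16 hn h15' h16
    rw [refund_bRec_eq_one hp0 (by omega), pairFloors_bRec_mid (by omega)]
    split_ifs <;> omega
  have h16' : 16 * n < p := lt_of_le_of_ne (by omega) (prime_ne_mul hprime hp5 (Or.inr (Or.inr rfl))).symm
  rw [pairFloors_bRec_mid (by omega)]
  by_cases h17 : p ≤ 17 * n
  · have := RecordRayTop.casLB_ge17 hn h16' h17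
    rw [refund_bRec_eq_one hp0 (by omega)]; split_ifs <;> omega
  by_cases h18 : p ≤ 18 * n
  · have := RecordRayTop.casLB_ge18 hn (by omega) h18
    rw [refund_bRec_eq_one hp0 (by omega)]; split_ifs <;> omega
  by_cases h25 : p ≤ 25 * n
  · have := RecordRayTop.casLB_ge25 hn (by omega) h25
    rw [refund_bRec_eq_one hp0 h25]; split_ifs <;> omega
  · have := RecordRayTop.casLB_ge41 hn (by omega) hp41
    rw [refund_bRec_eq_zero (by omega)]; split_ifs <;> omega

/-- **`RecordRayCV` (gen-2 g8) is a theorem [conjecture node discharged, by name, hypothesis-free]: (CV) ON THE WHOLE BROWN–ZUDILIN RECORD RAY**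
— `v_p(Cas_j(b(n))) ≥ min(1,⌊25n/p⌋) − N_p` for every `n ≥ 1`, every `1 ≤ j ≤ 7` and every window prime `5 ≤ p ≤ 41n`, `p² > 41n + 2`
(THEOREM LB `casoratianClassBound_holds` + `recordRayDominance_holds`, through the landed `recordRayCV_of_dominance`).
HONEST FRAMING: `p`-adic valuations of the cell's own explicit rationals; nothing about ζ(5) or irrationality. -/
theorem recordRayCV_holds : RecordRayCV := recordRayCV_of_dominance recordRayDominance_holds

end Summit.KontsevichZagierPeriods.Zeta5Search.ClusterValuation
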